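import Literature.Computability.AlgebraicComplexity.UnitTensorMomentPolytope
import Literature.Computability.AlgebraicComplexity.QuantumFunctionalsUpperMonotone
import Literature.Computability.AlgebraicComplexity.TensorRestrictionRank
import HarnessLib

/-!
# Occurrence of isotypic types is monotone under restriction; the rank-`≤ 4` part of `Δ(⟨4⟩) = Kron(4,4,4)`

Topic `Computability/AlgebraicComplexity`; sibling proofs file of `UnitTensorMomentPolytope.lean`
(named fact `vandenBergEtAl2025_unitTensor_four_polytope_maximal`: "`Δ(⟨4⟩) = Kron(4,4,4)`" in
semigroup form — every partition triple occurring in a power of a tensor `s` of format `≤ 4 × 4 × 4`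
has a multiple occurring in a power of the unit tensor `⟨4⟩`).

## What is proved here (sorry-free, no named facts)

* `isotypicSum₁₂₃_kroneckerPow_actTensor` — the triple isotypic character sum
  `P_λ := isotypicSum₁ λ⁰ ∘ isotypicSum₂ λ¹ ∘ isotypicSum₃ λ²` of `QuantumFunctionalsUpper.lean`
  satisfies `P_λ ((A ⊗ B ⊗ C)·t)^{⊗n} = (A^{⊗n} ⊗ B^{⊗n} ⊗ C^{⊗n}) P_λ t^{⊗n}` for ARBITRARY (rectangular)
  matrices `A, B, C` — assembled from the tree's `kroneckerPow_actTensor` and `isotypicSum_powActⱼ`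
  (`QuantumFunctionalsUpperMonotone.lean`, the printed proof of CVZ Lemma 3.6).
* `isotypicSum₁₂₃_kroneckerPow_ne_zero_of_actTensor` / `…_of_restrictsTo` — hence **occurrence is
  monotone under restriction**: if `λ` occurs in `s^{⊗n}` and `t ≥ s` (`TensorRestrictsTo t s`, any
  formats), then `λ` occurs in `t^{⊗n}`. This is the representation-theoretic form of
  "`T ⊵ T' ⇒ Δ(T) ⊇ Δ(T')`" [vandenBergChristandlLysikovNieuwboerWalterZuiddam2025, Prop. 2.7] for
  restrictions, and of Bürgisser–Ikenmeyer's remark that the semigroup of representations `S(w)` can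
  only shrink under degeneration [BurgisserIkenmeyer2011, §3.1, after (3.1)]; for restrictions no
  continuity argument is needed (the identity above is polynomial in `A, B, C`).
* `vandenBergEtAl2025_unitTensor_four_polytope_maximal_of_restrictsTo` /
  `…_of_tensorRank_le` — the named fact's conclusion **with `k = 1`** for every tensor `s` that is a
  restriction of `⟨4⟩`, in particular for every `s` of tensor rank `≤ 4` (BCS (14.19):
  `R(s) ≤ r ⟺ s ≤ ⟨r⟩`, tree: `tensorRestrictsTo_unitTensor_of_tensorRank_le`): there the UNSCALED
  semigroup inclusion `S(s) ⊆ S(⟨4⟩)` already holds;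
* `…_of_card_mul_card_le` — hence for every format two of whose dimensions have product `≤ 4`
  (`2 × 2 × c`, `1 × b × c`, …), by the slicing bounds `R(t) ≤ |ι|·|κ|`, `≤ |κ|·|μ|`, `≤ |ι|·|μ|`
  (`tensorRank_le_card_mul_card₁₂/₂₃/₁₃`, Bläser 2013 §4).

## What is NOT proved here (and why the named fact stays a cited hypothesis)

The named fact itself is the case of ALL `s ∈ ℂ^{≤4} ⊗ ℂ^{≤4} ⊗ ℂ^{≤4}` (rank up to the maximal rank
of the format), i.e. `Kron(4,4,4) ⊆ Δ(⟨4⟩)`. The source gives no proof: "Moreover, `Δ(⟨4⟩)` equals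
`Kron₄₄₄`, as can be seen using the tensor scaling algorithm and knowledge of the vertices of
`Kron₄₄₄`, which were determined in [Vergne–Walter 2017]" [vdBCLNWZ2025, §1 after Cor. 1.5]; the
companion paper reports the certified computation [vandenBergEtAl2025ComputingMomentPolytopes, §6.5]
and records that the vertices of `Kron₄₄₄` have denominators up to `24` (ibid. §6.2). A Lean proof
would need (i) the Vergne–Walter facet inequalities of `Kron₄₄₄` as theorems about isotypic
non-vanishing (Ressayre-type geometric invariant theory, absent from Mathlib and the tree) and
(ii) highest-weight evaluations in degrees `≥ 24` on `⟨4⟩` (`4^{24}` terms), plus the semigroup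
property of occurrence. None of this is attempted here; see the unit's `NOTES.md` (`## Census`).

## References

* [vandenBergChristandlLysikovNieuwboerWalterZuiddam2025] M. van den Berg, M. Christandl, V. Lysikov,
  H. Nieuwboer, M. Walter, J. Zuiddam, *The moment polytope of matrix multiplication is not maximal*,
  arXiv:2503.22633, §1 (after Cor. 1.5), §2.2 Prop. 2.7.
* [vandenBergEtAl2025ComputingMomentPolytopes] same authors, *Computing moment polytopes*,
  arXiv:2510.08336, §6.2, §6.5.
* [BurgisserIkenmeyer2011] P. Bürgisser, C. Ikenmeyer, *Geometric complexity theory and tensor rank*,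
  STOC 2011 = arXiv:1011.1350, §3.1.
* [ChristandlVranaZuiddam2023] M. Christandl, P. Vrana, J. Zuiddam, J. Amer. Math. Soc. 36 (2023),
  Lemma 3.6 (proof).
* [BurgisserClausenShokrollahi1997] P. Bürgisser, M. Clausen, M. A. Shokrollahi, *Algebraic Complexity
  Theory*, (14.19).
-/

noncomputable section

open scoped BigOperators

namespace Literature.Computability.AlgebraicComplexity

universe u

/-! ## Occurrence of isotypic types is monotone under restriction -/

section Monotone

variable {ι κ μ ι' κ' μ' : Type u} [Fintype ι] [Fintype κ] [Fintype μ]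
  [Fintype ι'] [Fintype κ'] [Fintype μ'] {n : ℕ}

/-- **Equivariance of the triple isotypic sum**:
`P_λ ((A ⊗ B ⊗ C)·t)^{⊗n} = (A^{⊗n} ⊗ B^{⊗n} ⊗ C^{⊗n}) (P_λ t^{⊗n})` for arbitrary matrices
`A, B, C` (CVZ, proof of Lemma 3.6: `P_λ^{W} (A₁ ⊗ A₂ ⊗ A₃)^{⊗n} = (A₁ ⊗ A₂ ⊗ A₃)^{⊗n} P_λ^{V}` and
`((A ⊗ B ⊗ C)·t)^{⊗n} = (A ⊗ B ⊗ C)^{⊗n} t^{⊗n}`).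
[cite: ChristandlVranaZuiddam2023, Lemma 3.6 (proof)] -/
theorem isotypicSum₁₂₃_kroneckerPow_actTensor [DecidableEq ι] [DecidableEq κ]
    (A : Matrix ι' ι ℂ) (B : Matrix κ' κ ℂ) (C : Matrix μ' μ ℂ) (t : ι → κ → μ → ℂ)
    (lam : Fin 3 → Nat.Partition n) :
    isotypicSum₁ (lam 0) (isotypicSum₂ (lam 1) (isotypicSum₃ (lam 2)
        (kroneckerPow (actTensor A B C t) n))) =
      powAct₁ A (powAct₂ B (powAct₃ C
        (isotypicSum₁ (lam 0) (isotypicSum₂ (lam 1) (isotypicSum₃ (lam 2) (kroneckerPow t n)))))) := by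
  classical
  rw [kroneckerPow_actTensor]
  simp only [(isotypicSum_powAct₁ _ A _).1, (isotypicSum_powAct₁ _ A _).2.1,
    (isotypicSum_powAct₁ _ A _).2.2, (isotypicSum_powAct₂ _ B _).1, (isotypicSum_powAct₂ _ B _).2.1,
    (isotypicSum_powAct₂ _ B _).2.2, (isotypicSum_powAct₃ _ C _).1, (isotypicSum_powAct₃ _ C _).2.1,
    (isotypicSum_powAct₃ _ C _).2.2]

/-- **Occurrence is monotone under restriction** (matrix form): if the isotypic projection of type
`λ = (λ⁰, λ¹, λ²)` does not kill `((A ⊗ B ⊗ C)·t)^{⊗n}`, it does not kill `t^{⊗n}` — for arbitrary,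
possibly rectangular or singular, `A, B, C`. Representation-theoretic form of
`T ≥ T' ⇒ Δ(T) ⊇ Δ(T')` and of "`S(w)` can only decrease under degenerations".
[cite: vandenBergChristandlLysikovNieuwboerWalterZuiddam2025, Prop. 2.7]
[cite: BurgisserIkenmeyer2011, §3.1] -/
theorem isotypicSum₁₂₃_kroneckerPow_ne_zero_of_actTensor [DecidableEq ι] [DecidableEq κ]
    {A : Matrix ι' ι ℂ} {B : Matrix κ' κ ℂ} {C : Matrix μ' μ ℂ} {t : ι → κ → μ → ℂ}
    {lam : Fin 3 → Nat.Partition n}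
    (h : isotypicSum₁ (lam 0) (isotypicSum₂ (lam 1) (isotypicSum₃ (lam 2)
        (kroneckerPow (actTensor A B C t) n))) ≠ 0) :
    isotypicSum₁ (lam 0) (isotypicSum₂ (lam 1) (isotypicSum₃ (lam 2) (kroneckerPow t n))) ≠ 0 := by
  intro h0
  apply h
  rw [isotypicSum₁₂₃_kroneckerPow_actTensor, h0, powAct₃_zero, powAct₂_zero, powAct₁_zero]

/-- **Occurrence is monotone under restriction** (`TensorRestrictsTo` form, any formats): if `t ≥ s`
and `λ` occurs in `s^{⊗n}` (the triple isotypic character sum does not kill it), then `λ` occurs in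
`t^{⊗n}`. [cite: vandenBergChristandlLysikovNieuwboerWalterZuiddam2025, Prop. 2.7]
[cite: BurgisserIkenmeyer2011, §3.1] -/
theorem isotypicSum₁₂₃_kroneckerPow_ne_zero_of_restrictsTo {t : ι → κ → μ → ℂ}
    {s : ι' → κ' → μ' → ℂ} (hts : TensorRestrictsTo t s) {lam : Fin 3 → Nat.Partition n}
    (h : isotypicSum₁ (lam 0) (isotypicSum₂ (lam 1) (isotypicSum₃ (lam 2) (kroneckerPow s n))) ≠ 0) :
    isotypicSum₁ (lam 0) (isotypicSum₂ (lam 1) (isotypicSum₃ (lam 2) (kroneckerPow t n))) ≠ 0 := by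
  classical
  obtain ⟨A, B, C, rfl⟩ := (tensorRestrictsTo_iff_exists_actTensor t s).1 hts
  exact isotypicSum₁₂₃_kroneckerPow_ne_zero_of_actTensor h

end Monotone

/-! ## The named fact for restrictions of `⟨4⟩` (the unscaled case `k = 1`) -/

/-- **`Δ(s) ⊆ Δ(⟨4⟩)` for restrictions `s ≤ ⟨4⟩`, in the semigroup form of
`vandenBergEtAl2025_unitTensor_four_polytope_maximal` with `k = 1`**: if `⟨4⟩ ≥ s` then every
partition triple `λ ⊢ n` occurring in `s^{⊗n}` occurs in `⟨4⟩^{⊗n}` itself, so the conclusion of the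
named fact holds with `k = 1`, `μ = λ`. (The general fact — all `s` of format `≤ 4×4×4`, where a
scaling `k ≥ 2` can be necessary, BI 2011 Lemma 6.1 — is `Kron(4,4,4) ⊆ Δ(⟨4⟩)` and is NOT proved in
the tree; module docstring.) [cite: vandenBergChristandlLysikovNieuwboerWalterZuiddam2025, Prop. 2.7 and §1 after Cor. 1.5] -/
theorem vandenBergEtAl2025_unitTensor_four_polytope_maximal_of_restrictsTo
    {ι κ μ : Type} [Fintype ι] [Fintype κ] [Fintype μ] {s : ι → κ → μ → ℂ}
    (hs : TensorRestrictsTo (unitTensor ℂ 4) s) {n : ℕ} {lam : Fin 3 → Nat.Partition n}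
    (h : isotypicSum₁ (lam 0) (isotypicSum₂ (lam 1) (isotypicSum₃ (lam 2) (kroneckerPow s n))) ≠ 0) :
    ∃ (k : ℕ) (mu : Fin 3 → Nat.Partition (k * n)), 0 < k ∧
      (∀ j, (mu j).parts = (lam j).parts.map (fun p => k * p)) ∧
        isotypicSum₁ (mu 0) (isotypicSum₂ (mu 1) (isotypicSum₃ (mu 2)
          (kroneckerPow (unitTensor ℂ 4) (k * n)))) ≠ 0 := by
  have key := isotypicSum₁₂₃_kroneckerPow_ne_zero_of_restrictsTo hs h
  suffices H : ∀ (m : ℕ), n = m → ∃ mu : Fin 3 → Nat.Partition m,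
      (∀ j, (mu j).parts = (lam j).parts.map (fun p => 1 * p)) ∧
        isotypicSum₁ (mu 0) (isotypicSum₂ (mu 1) (isotypicSum₃ (mu 2)
          (kroneckerPow (unitTensor ℂ 4) m))) ≠ 0 by
    obtain ⟨mu, hmu, hne⟩ := H (1 * n) (one_mul n).symm
    exact ⟨1, mu, one_pos, hmu, hne⟩
  rintro m rfl
  exact ⟨lam, fun j => by simp, key⟩

/-- **The named fact for tensors of rank `≤ 4`** (`k = 1`): a tensor of rank `≤ 4` is a restriction of
`⟨4⟩` (BCS (14.19), tree: `tensorRestrictsTo_unitTensor_of_tensorRank_le`), so every partition triple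
occurring in one of its powers occurs in the same power of `⟨4⟩`.
[cite: vandenBergChristandlLysikovNieuwboerWalterZuiddam2025, Prop. 2.7 and §1 after Cor. 1.5]
[cite: BurgisserClausenShokrollahi1997, (14.19)] -/
theorem vandenBergEtAl2025_unitTensor_four_polytope_maximal_of_tensorRank_le
    {ι κ μ : Type} [Fintype ι] [Fintype κ] [Fintype μ] {s : ι → κ → μ → ℂ}
    (hs : tensorRank s ≤ 4) {n : ℕ} {lam : Fin 3 → Nat.Partition n}
    (h : isotypicSum₁ (lam 0) (isotypicSum₂ (lam 1) (isotypicSum₃ (lam 2) (kroneckerPow s n))) ≠ 0) :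
    ∃ (k : ℕ) (mu : Fin 3 → Nat.Partition (k * n)), 0 < k ∧
      (∀ j, (mu j).parts = (lam j).parts.map (fun p => k * p)) ∧
        isotypicSum₁ (mu 0) (isotypicSum₂ (mu 1) (isotypicSum₃ (mu 2)
          (kroneckerPow (unitTensor ℂ 4) (k * n)))) ≠ 0 :=
  vandenBergEtAl2025_unitTensor_four_polytope_maximal_of_restrictsTo
    (tensorRestrictsTo_unitTensor_of_tensorRank_le s hs) h

/-! ## Formats with two small dimensions: rank bounds by slicing -/

section Slicing

variable {K : Type*} [CommSemiring K] {ι κ μ : Type*} [Fintype ι] [Fintype κ] [Fintype μ]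

omit [Fintype μ] in
/-- **`R(t) ≤ |ι|·|κ|`**: slicing along the third factor, `t = ∑_{a,b} e_a ⊗ e_b ⊗ t(a,b,·)`
(Bläser 2013 §4: a tensor is the sum of its `|ι|·|κ|` fibres `e_a ⊗ e_b ⊗ t(a,b,·)`, each a triad).
[cite: Blaser2013, §4] -/
theorem tensorRank_le_card_mul_card₁₂ [DecidableEq ι] [DecidableEq κ] (t : ι → κ → μ → K) :
    tensorRank t ≤ Fintype.card ι * Fintype.card κ := by
  rw [← Fintype.card_prod]
  refine tensorRank_le_card_of_eq_sum (fun p : ι × κ => Pi.single p.1 1) (fun p => Pi.single p.2 1)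
    (fun p => t p.1 p.2) ?_
  funext a b c
  rw [Finset.sum_apply, Finset.sum_apply, Finset.sum_apply]
  simp only [triad_apply]
  rw [Fintype.sum_eq_single (a, b)]
  · simp
  · rintro ⟨a', b'⟩ hne
    by_cases ha : a' = a
    · subst ha
      have hb : b' ≠ b := fun h => hne (by rw [h])
      simp [hb.symm]
    · have ha' : a ≠ a' := fun h => ha h.symm
      simp [Pi.single_apply, ha']

omit [Fintype ι] in
/-- **`R(t) ≤ |κ|·|μ|`**: slicing along the first factor, `t = ∑_{b,c} t(·,b,c) ⊗ e_b ⊗ e_c`.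
[cite: Blaser2013, §4] -/
theorem tensorRank_le_card_mul_card₂₃ [DecidableEq κ] [DecidableEq μ] (t : ι → κ → μ → K) :
    tensorRank t ≤ Fintype.card κ * Fintype.card μ := by
  rw [← Fintype.card_prod]
  refine tensorRank_le_card_of_eq_sum (fun p : κ × μ => fun a => t a p.1 p.2) (fun p => Pi.single p.1 1)
    (fun p => Pi.single p.2 1) ?_
  funext a b c
  rw [Finset.sum_apply, Finset.sum_apply, Finset.sum_apply]
  simp only [triad_apply]
  rw [Fintype.sum_eq_single (b, c)]
  · simp
  · rintro ⟨b', c'⟩ hne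
    by_cases hb : b' = b
    · subst hb
      have hc : c' ≠ c := fun h => hne (by rw [h])
      simp [hc.symm]
    · have hb' : b ≠ b' := fun h => hb h.symm
      simp [Pi.single_apply, hb']

omit [Fintype κ] in
/-- **`R(t) ≤ |ι|·|μ|`**: slicing along the second factor, `t = ∑_{a,c} e_a ⊗ t(a,·,c) ⊗ e_c`.
[cite: Blaser2013, §4] -/
theorem tensorRank_le_card_mul_card₁₃ [DecidableEq ι] [DecidableEq μ] (t : ι → κ → μ → K) :
    tensorRank t ≤ Fintype.card ι * Fintype.card μ := by
  rw [← Fintype.card_prod]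
  refine tensorRank_le_card_of_eq_sum (fun p : ι × μ => Pi.single p.1 1) (fun p => fun b => t p.1 b p.2)
    (fun p => Pi.single p.2 1) ?_
  funext a b c
  rw [Finset.sum_apply, Finset.sum_apply, Finset.sum_apply]
  simp only [triad_apply]
  rw [Fintype.sum_eq_single (a, c)]
  · simp
  · rintro ⟨a', c'⟩ hne
    by_cases ha : a' = a
    · subst ha
      have hc : c' ≠ c := fun h => hne (by rw [h])
      simp [hc.symm]
    · have ha' : a ≠ a' := fun h => ha h.symm
      simp [Pi.single_apply, ha']

end Slicing

/-- **The named fact for formats with two dimensions of product `≤ 4`** (`k = 1`): if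
`|ι|·|κ| ≤ 4` or `|κ|·|μ| ≤ 4` or `|ι|·|μ| ≤ 4` (e.g. every format `2 × 2 × c`, `1 × b × c`,
`2 × 1 × 4`, …) then `s` has rank `≤ 4`, hence is a restriction of `⟨4⟩`, and every partition triple
occurring in one of its powers occurs in the same power of `⟨4⟩`. (The general fact needs all
formats up to `4 × 4 × 4`, where ranks up to the maximal rank of the format occur and `k ≥ 2` can
be necessary.) [cite: vandenBergChristandlLysikovNieuwboerWalterZuiddam2025, Prop. 2.7 and §1 after Cor. 1.5]
[cite: BurgisserClausenShokrollahi1997, (14.19)] -/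
theorem vandenBergEtAl2025_unitTensor_four_polytope_maximal_of_card_mul_card_le
    {ι κ μ : Type} [Fintype ι] [Fintype κ] [Fintype μ] {s : ι → κ → μ → ℂ}
    (hs : Fintype.card ι * Fintype.card κ ≤ 4 ∨ Fintype.card κ * Fintype.card μ ≤ 4 ∨
      Fintype.card ι * Fintype.card μ ≤ 4)
    {n : ℕ} {lam : Fin 3 → Nat.Partition n}
    (h : isotypicSum₁ (lam 0) (isotypicSum₂ (lam 1) (isotypicSum₃ (lam 2) (kroneckerPow s n))) ≠ 0) :
    ∃ (k : ℕ) (mu : Fin 3 → Nat.Partition (k * n)), 0 < k ∧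
      (∀ j, (mu j).parts = (lam j).parts.map (fun p => k * p)) ∧
        isotypicSum₁ (mu 0) (isotypicSum₂ (mu 1) (isotypicSum₃ (mu 2)
          (kroneckerPow (unitTensor ℂ 4) (k * n)))) ≠ 0 := by
  classical
  refine vandenBergEtAl2025_unitTensor_four_polytope_maximal_of_tensorRank_le ?_ h
  rcases hs with h12 | h23 | h13
  · exact (tensorRank_le_card_mul_card₁₂ s).trans h12
  · exact (tensorRank_le_card_mul_card₂₃ s).trans h23
  · exact (tensorRank_le_card_mul_card₁₃ s).trans h13

end Literature.Computability.AlgebraicComplexity
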